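import Mathlib
import HarnessLib
import Literature.MathematicalPhysics.KineticTheory.HardSphereEulerProofs
import Summits.AtomisticToContinuum.HydrodynamicLimit.Theses.OneFlightGossipEngine
import Summits.AtomisticToContinuum.HydrodynamicLimit.Theses.TwoClocks
import Summits.AtomisticToContinuum.HydrodynamicLimit.Theorems.OneFlightGossipEngineLocalClampedTransferLDAlongFamiliesSAxisNetPrelim
import Summits.AtomisticToContinuum.HydrodynamicLimit.Theorems.KineticWindowGronwall.Negative.ActivityDummy

/-! # C⁺♯ implies TwoClocks' crux C′ — stub `stub_cPlusImpliesRung` of line `Sketch`, crux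
# `LocalClampedTransferLDAlongFamilies` (stmt-AtomisticToContinuum-17691)

Route `OneFlightGossipEngine`, sub-problem `HydrodynamicLimit`. The kernel certificate that the line's open node
S1 `CPlusSharp` (C⁺♯: TwoClocks' equilibrium crux C′ `ClampedTransferWindowLD`, stmt-AtomisticToContinuum-16623,
made UNIFORM over a compact parameter box — reduced density `σlo ≤ σ ≤ σhi`, temperature `θlo ≤ θ₀ ≤ θhi`,
drift `‖u₀‖ ≤ U`, window multiplier `mlo ≤ m ≤ mhi` — and over a `C²`-ball of test functions, with the flow
quantified innermost) is crux-sized: it implies C′ outright, `CPlusSharp → TwoClocks.ClampedTransferWindowLD`.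

Proof: quantifier threading. Given the packing guard `η₀` of C⁺♯ take `σ₀ := min (1/2) η₀`; for
`σ ∈ (0, σ₀)` one has `σ < 1/2` and `σ³ ≤ σ ≤ η₀`. Apply C⁺♯ on the degenerate box `σlo = σhi = σ`,
`θlo = θhi = θ₀`, `U = ‖u₀‖`, `mlo = mhi = 1`, `Lφ = L` (a bound of the first and second derivatives of the
smooth test function, `exists_abs_partialDeriv_le`), thread `V₀, V, β₀, β, ε, τ₀, τ, N₀, N` (the two quantifier
strings coincide from `∃ V₀` on), and instantiate the innermost block at `(σ, θ₀, 1, u₀)`, `φ` and the family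
member `Φ N`. The two `let` blocks then agree after `1 * τ = τ` and the invariance of the canonical local Gibbs
law under a positive constant activity at fixed particle number,
`localGibbsLaw σ a₀ u₀ θ₀ N = localGibbsLaw σ 1 u₀ θ₀ N` (`KineticWindowGronwallNegative.localGibbsLaw_const_activity`:
the factor `a₀^(N+1)` cancels between the tensor power and the partition function).

References: S. Olla, S. R. S. Varadhan, H.-T. Yau, Comm. Math. Phys. 155 (1993) §2–3 (the equilibrium LD input of
the relative-entropy method); H. Spohn, *Large Scale Dynamics of Interacting Particles* (1991), Part I §2.3. -/

noncomputable section

open MeasureTheory Set Filter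
open scoped ENNReal Topology BigOperators

namespace Summit.AtomisticToContinuum.HydrodynamicLimit.Theorems.LocalClampedTransferSketch

open Literature.Analysis.FluidPDE (HardSphereFlow Config localMaxwellian canonicalDensity liouville
  hardSphereDomain configEnergy)
open Literature.MathematicalPhysics.KineticTheory (T3 V3 hsDiameter localGibbsLaw localGibbsMeasure
  localGibbsProfile rhoLim profileOf hsCompressibility)
open Literature.Analysis.FluidPDE Literature.MathematicalPhysics.KineticTheory Literature.Analysis.FunctionSpaces

/-! ### The registered Prop -/

/-- registered stub signature S1 `stub_cPlus` of line Sketch, crux LocalClampedTransferLDAlongFamilies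
(stmt-AtomisticToContinuum-17691) — route-internal, not a cited fact. C⁺♯ — the box-uniform equilibrium node:
TwoClocks' crux C′ (`ClampedTransferWindowLD`, stmt-16623: the transfer-clamped collisional window LD at GLOBAL
equilibrium) with `V₀, β₀, τ₀, N₀` uniform over reduced density `σlo ≤ σ ≤ σhi` (`σhi³ ≤ η₀`), temperature
`θlo ≤ θ₀ ≤ θhi`, drift `‖u₀‖ ≤ U`, window multiplier `mlo ≤ m ≤ mhi` (window `w = mτ(N+1)^{-1/3}`, activity
normalised by `ε_N/w = σ/(mτ)`), smooth `φ` with `|∂φ|, |∂∂φ| ≤ Lφ` (the thresholds ALSO uniform over test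
functions in a `C²`-ball of radius `Lφ` — the only form the cell transfer can consume; ideator 2's
`UniformEquilibriumClampedTransferLD`), the flow innermost. Constant activity `1` (`ρ₀ ≡ 1`), `Z = Z(σ³)`,
`Z′ = Z′(σ³)`, no centring (`∫∂ₖφ = 0`). OPEN (⊇ 16623). -/
def CPlusSharp : Prop :=
  ∃ η₀ : ℝ, 0 < η₀ ∧ ∀ (σlo σhi θlo θhi U mlo mhi Lφ : ℝ),
    0 < σlo → σlo ≤ σhi → σhi < 1 / 2 → σhi ^ 3 ≤ η₀ → 0 < θlo → θlo ≤ θhi → 0 ≤ U →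
    0 < mlo → mlo ≤ mhi → 0 ≤ Lφ →
    ∃ V₀ : ℝ, 0 < V₀ ∧ ∀ V : ℝ, V₀ ≤ V → ∃ β₀ : ℝ, 0 < β₀ ∧ ∀ β : ℝ, |β| ≤ β₀ →
    ∀ ε : ℝ, 0 < ε → ∃ τ₀ : ℝ, 0 < τ₀ ∧ ∀ τ : ℝ, τ₀ ≤ τ → ∃ N₀ : ℕ, ∀ N : ℕ, N₀ ≤ N →
    ∀ (σ θ₀ m : ℝ) (u₀ : V3), σlo ≤ σ → σ ≤ σhi → θlo ≤ θ₀ → θ₀ ≤ θhi → ‖u₀‖ ≤ U →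
      mlo ≤ m → m ≤ mhi →
    ∀ φ : T3 → ℝ, Torus.IsSmooth φ →
      (∀ (k : Fin 3) x, |Torus.partialDeriv k φ x| ≤ Lφ) →
      (∀ (k l : Fin 3) x, |Torus.partialDeriv k (Torus.partialDeriv l φ) x| ≤ Lφ) →
    ∀ Φ : HardSphereFlow (Torus.geometry (Fin 3)) (hsDiameter σ N) (N + 1),
      (let w : ℝ := m * τ * ((N : ℝ) + 1) ^ (-(1 / 3 : ℝ))
       let P := localGibbsLaw σ (fun _ => (1 : ℝ)) (fun _ => u₀) (fun _ => θ₀) N Φ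
       let Z : ℝ := hsCompressibility (σ ^ 3)
       let Z' : ℝ := deriv hsCompressibility (σ ^ 3)
       let act := fun (i : Fin (N + 1)) (z : Config (N + 1) (Fin 3) T3) =>
         σ / (m * τ) * Φ.collisionSum (Set.Ioc 0 w)
           (fun c => if c.fst = i then ‖c.postVel.1 - c.preVel.1‖ +
             |‖c.postVel.1‖ ^ 2 - ‖c.preVel.1‖ ^ 2| / 2 else 0) z
       let ω := fun (i : Fin (N + 1)) (z : Config (N + 1) (Fin 3) T3) =>
         if act i z ≤ V then (1 : ℝ) else 0
       let Xm := fun (k : Fin 3) (z : Config (N + 1) (Fin 3) T3) =>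
         Φ.collisionSum (Set.Ioc 0 w) (fun c => ω c.fst z * ω c.snd z *
           ((φ c.fstPos - φ c.sndPos) * (c.postVel.1 k - c.preVel.1 k)) / 2) z
       let Am := fun (k : Fin 3) (z : Config (N + 1) (Fin 3) T3) =>
         ∫ r in (0 : ℝ)..w, ∑ i, Torus.partialDeriv k φ ((Φ.flow r z i).1) *
           (θ₀ * σ ^ 3 * Z' + (1 / 3) * (Z - 1) * ‖(Φ.flow r z i).2 - u₀‖ ^ 2)
       let Xe := fun (z : Config (N + 1) (Fin 3) T3) =>
         Φ.collisionSum (Set.Ioc 0 w) (fun c => ω c.fst z * ω c.snd z *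
           ((φ c.fstPos - φ c.sndPos) * ((‖c.postVel.1‖ ^ 2 - ‖c.preVel.1‖ ^ 2) / 2)) / 2) z
       let Ae := fun (z : Config (N + 1) (Fin 3) T3) =>
         ∫ r in (0 : ℝ)..w, ∑ i, ((∑ l, u₀ l * Torus.partialDeriv l φ ((Φ.flow r z i).1)) *
           (θ₀ * σ ^ 3 * Z' + (1 / 3) * (Z - 1) * ‖(Φ.flow r z i).2 - u₀‖ ^ 2) +
           θ₀ * (Z - 1) * (∑ l, Torus.partialDeriv l φ ((Φ.flow r z i).1) *
             (((Φ.flow r z i).2 - u₀) l)))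
       (∀ k : Fin 3, ∫⁻ z, ENNReal.ofReal (Real.exp (β * (w⁻¹ * Xm k z - w⁻¹ * Am k z))) ∂P ≤
           ENNReal.ofReal (Real.exp (ε * ((N : ℝ) + 1)))) ∧
         ∫⁻ z, ENNReal.ofReal (Real.exp (β * (w⁻¹ * Xe z - w⁻¹ * Ae z))) ∂P ≤
           ENNReal.ofReal (Real.exp (ε * ((N : ℝ) + 1))))

/-! ### The certificate -/

/-- Packing guard from smallness: `0 < σ < min (1/2) η₀` gives `σ ^ 3 ≤ η₀` (since `σ ^ 3 ≤ σ` for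
`0 ≤ σ ≤ 1`). -/
theorem pow_three_le_of_lt_min_half {σ η₀ : ℝ} (hσ : 0 < σ) (h : σ < min (1 / 2) η₀) : σ ^ 3 ≤ η₀ := by
  have h2 : σ < 1 / 2 := h.trans_le (min_le_left _ _)
  have hη : σ < η₀ := h.trans_le (min_le_right _ _)
  have h1 : σ ≤ 1 := by linarith
  exact (pow_le_of_le_one hσ.le h1 three_ne_zero).trans hη.le

/-- **C⁺♯ is crux-sized**: the box-uniform equilibrium node `CPlusSharp` implies TwoClocks' pointwise crux C′
`ClampedTransferWindowLD` (stmt-AtomisticToContinuum-16623) — degenerate box `σlo = σhi = σ`, `θlo = θhi = θ₀`,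
`U = ‖u₀‖`, `mlo = mhi = m = 1`, `Lφ` a derivative bound of `φ`, flow `Φ N`; the activity `a₀` is removed by the
scale invariance of the canonical local Gibbs law. -/
theorem stub_cPlusImpliesRung : CPlusSharp → Summit.AtomisticToContinuum.HydrodynamicLimit.Theses.TwoClocks.ClampedTransferWindowLD := by
  rintro ⟨η₀, hη₀, hC⟩
  refine ⟨min (1 / 2) η₀, lt_min one_half_pos hη₀, ?_⟩
  intro a₀ θ₀ u₀ ha₀ hθ₀ σ hσ hσ₀ Φ φ hφ
  have hσ2 : σ < 1 / 2 := hσ₀.trans_le (min_le_left _ _)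
  have hσ3 : σ ^ 3 ≤ η₀ := pow_three_le_of_lt_min_half hσ hσ₀
  obtain ⟨L, hL0, hL1, hL2⟩ := exists_abs_partialDeriv_le hφ
  obtain ⟨V₀, hV₀, hV⟩ := hC σ σ θ₀ θ₀ ‖u₀‖ 1 1 L hσ le_rfl hσ2 hσ3 hθ₀ le_rfl (norm_nonneg _)
    one_pos le_rfl hL0
  refine ⟨V₀, hV₀, fun V hVV => ?_⟩
  obtain ⟨β₀, hβ₀, hβ⟩ := hV V hVV
  refine ⟨β₀, hβ₀, fun β hββ ε hε => ?_⟩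
  obtain ⟨τ₀, hτ₀, hτ⟩ := hβ β hββ ε hε
  refine ⟨τ₀, hτ₀, fun τ hττ => ?_⟩
  obtain ⟨N₀, hN⟩ := hτ τ hττ
  refine ⟨N₀, fun N hNN => ?_⟩
  have h := hN N hNN σ θ₀ 1 u₀ le_rfl le_rfl le_rfl le_rfl le_rfl le_rfl le_rfl φ hφ hL1 hL2 (Φ N)
  rw [KineticWindowGronwallNegative.localGibbsLaw_const_activity ha₀.ne' σ θ₀ u₀ N (Φ N), ← one_mul τ]
  exact h

end Summit.AtomisticToContinuum.HydrodynamicLimit.Theorems.LocalClampedTransferSketch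

end
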